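import Summits.ABC.StewartYu.PadicG3SatNLines
import Summits.ABC.StewartYu.PadicG3SatNCount
import HarnessLib

/-!
# Cell abc-stewartyu, WP-L.P(odd) (crux r3 `PadicCoreOddRat`, stmt-ABC-20503): THE SATURATED INEQUALITY PACK `IneqPackSat S F (schedN 1)` FROM THE
# RECORD'S COUNT, SMALLNESS EXPONENT AND FOUR BUDGET INEQUALITIES (budget-parametric assembly)

`Summits/ABC/StewartYu/PadicG3SatNPack.lean` — cell `abc-stewartyu` (seat p2-g6; pack twin, assembly; record owner p1 g10).  Proofs only; no definition,
no named fact.  Twin of `PadicG3VbPack.ineqPackR₃_schedVb_one` (p3-g7): the five conjuncts of `IneqPackSat S F (P.schedN 1)` from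
(B1) a count `2·#(nodes×orders)·((p−1)p^m) ≤ (L0N+1)·(N·∏(2·sⱼ))` (p1's `siegel_countN` shape) under the index identity `N = |det C|`;
a smallness `‖Λ/b̃_{k₀}‖ ≤ e^{−U}`; and FOUR budget inequalities in the closed forms of `PadicG3SatNSizesB`/`PadicG3SatNHalfSizes` with
`T0r := (69/4)(n+1)LgV + 2(n+1)(ŜN − ŜG)`, `cX := HV + W` (valid under `hNCW : log N + log n! + 3 log n ≤ W`), `Thr := 2LgV + (n+1)(8LgV + 2ŜN)`:
k-steps `hKfar`/`hKlam`, half-steps `hHfar`/`hHlam` (far sides against `8·2^ν·Zp ≤ zerosV`, `Λ` sides against `U`).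

* `cX_of_hNCW` (`log 2 + 3 log n + log n! + log N + W + log LV ≤ HV + W`), `ineqPackSat_schedN_one`.

References: Yu. V. Nesterenko, LNM 1819 (2003) Prop 4.1, Lemma 4.3, §4.3 (shape only).
-/

noncomputable section

open Finset Real
open Literature.NumberTheory.Transcendental
open Literature.NumberTheory.Transcendental.PadicCW77 (condExp)
open Literature.NumberTheory.Transcendental.CW77.Setup (Tau tauNorm)

namespace Summit.ABC.StewartYu

namespace G3Setup

variable {p : ℕ} [Fact p.Prime] (S : G3Setup p) (F : S.SatData) (P : PadicG3ParN S.n)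

/-- The directional log under the single budget letter: `log 2 + 3 log n + log n! + log N + W + log LV ≤ HV + W`
(`log N + log n! + 3 log n ≤ W`, `W + log LV + log 2 ≤ HV`). [folklore] -/
theorem cX_of_hNCW (hPN : P.N = F.N) (hNCW : Real.log F.N + Real.log S.n.factorial + 3 * Real.log S.n ≤ P.W) :
    Real.log 2 + 3 * Real.log S.n + Real.log S.n.factorial + Real.log F.N + P.W + Real.log P.LV ≤ P.HV + P.W := by
  have _h := hPN
  have h := P.W_log_LV_le_HV
  linarith

/-- **THE SATURATED INEQUALITY PACK at `schedN 1` from the record's count, smallness and four budget inequalities.**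
[cite: Nesterenko2003, Prop 4.1, Lemma 4.3, §4.3; shape only] -/
theorem ineqPackSat_schedN_one (hp : P.p = p) (hθ : P.θ₀ = 1 / 2) (hn2 : 2 ≤ S.n) (hA1 : ∀ j, 1 ≤ P.A j)
    (hαA : ∀ j, Height.logHeight₁ (F.αo j) ≤ P.A j) (hbW : ∀ j, Real.log (max 3 (|S.b j| : ℝ)) ≤ P.W)
    (hC : ∀ j k, |F.C j k| ≤ ((S.n.factorial * F.N : ℕ) : ℤ)) (hUcol : ∀ j, (F.Ucol j : ℤ) ≤ S.n * F.N)
    (hθA : ∀ i, Height.logHeight₁ (S.α i) ≤ ∑ j, P.A j) (hdet : (F.N : ℤ) = |F.C.det|) (hPN : P.N = F.N) (hNq : P.Nq = P.K)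
    (hNCW : Real.log F.N + Real.log S.n.factorial + 3 * Real.log S.n ≤ P.W)
    (hB1 : 2 * (Icc (-(S.NS (P.schedN 1) 0 0 : ℤ)) (S.NS (P.schedN 1) 0 0) ×ˢ tauSetR S.n S.j₀ (S.TordS (P.schedN 1) 0 0)).card *
        ((p - 1) * p ^ P.m) ≤ (P.L0N + 1) * (F.N * ∏ j, (2 * S.sideS₂ (P.schedN 1) j)))
    {U : ℝ} (hΛU : ‖S.Λ / (S.b S.j₀ : ℚ_[p])‖ ≤ Real.exp (-U))
    (hKfar : ∀ ν, ν + 1 ≤ S.n → P.L0N * (P.G + 1) +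
      (4 * Real.log 2 + 2 * (Real.log ((P.L0N : ℝ) + 1) + S.n * Real.log (S.n * S.n.factorial * F.N * P.LV + 1)) +
        2 * (((69 / 4) * (S.n + 1) * P.LgV + 2 * (S.n + 1) * ((P.SdN : ℝ) - P.SdG)) * (P.SdN * Real.log 2 + 23 / 20 * P.HV + (P.HV + P.W))) +
        2 * (P.HV / Real.exp 1) + 2 * (P.L0N * ((P.SdN + S.n + 6) * Real.log 2)) + 2 * P.htsV 0 + 4 * P.htsV ν + 8 * ∑ j, P.A j) <
      8 * 2 ^ ν * P.Zp)
    (hKlam : ∀ lev ν, lev ≤ P.SdN → ν + 1 ≤ S.n → P.L0N * (P.G + 1) + P.AcondV lev ν +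
      (4 * Real.log 2 + 2 * (Real.log ((P.L0N : ℝ) + 1) + S.n * Real.log (S.n * S.n.factorial * F.N * P.LV + 1)) +
        2 * (((69 / 4) * (S.n + 1) * P.LgV + 2 * (S.n + 1) * ((P.SdN : ℝ) - P.SdG)) * (P.SdN * Real.log 2 + 23 / 20 * P.HV + (P.HV + P.W))) +
        2 * (P.HV / Real.exp 1) + 2 * (P.L0N * ((P.SdN + S.n + 6) * Real.log 2)) + 2 * P.htsV 0 + 4 * P.htsV ν + 8 * ∑ j, P.A j) < U)
    (hHfar : P.L0N * (P.G + 1) + 2 ^ (S.n + 1) *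
      (6 * Real.log 2 + 2 * (Real.log ((P.L0N : ℝ) + 1) + S.n * Real.log (S.n * S.n.factorial * F.N * P.LV + 1)) +
        ((69 / 4) * (S.n + 1) * P.LgV + 2 * (S.n + 1) * ((P.SdN : ℝ) - P.SdG)) * (P.SdN * Real.log 2 + 23 / 20 * P.HV + (P.HV + P.W)) +
        2 * (P.HV / Real.exp 1) + 2 * (P.L0N * ((P.SdN + S.n + 6) * Real.log 2)) +
        8 * P.htsV 0 + (2 * P.LgV + (S.n + 1) * (8 * P.LgV + 2 * P.SdN)) * (P.SdN * Real.log 2 + Real.log 2 + 69 / 20 * P.HV + 2 * P.W + (P.HV + P.W)) +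
        (6 * S.n + 10) * ∑ j, P.A j) < 8 * 2 ^ S.n * P.Zp)
    (hHlam : ∀ lev, lev < P.SdN → P.L0N * (P.G + 1) + P.AcondV lev S.n + 2 ^ (S.n + 1) *
      (6 * Real.log 2 + 2 * (Real.log ((P.L0N : ℝ) + 1) + S.n * Real.log (S.n * S.n.factorial * F.N * P.LV + 1)) +
        ((69 / 4) * (S.n + 1) * P.LgV + 2 * (S.n + 1) * ((P.SdN : ℝ) - P.SdG)) * (P.SdN * Real.log 2 + 23 / 20 * P.HV + (P.HV + P.W)) +
        2 * (P.HV / Real.exp 1) + 2 * (P.L0N * ((P.SdN + S.n + 6) * Real.log 2)) +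
        8 * P.htsV 0 + (2 * P.LgV + (S.n + 1) * (8 * P.LgV + 2 * P.SdN)) * (P.SdN * Real.log 2 + Real.log 2 + 69 / 20 * P.HV + 2 * P.W + (P.HV + P.W)) +
        (6 * S.n + 10) * ∑ j, P.A j) < U) :
    S.IneqPackSat F (P.schedN 1) := by
  have hn1 : 1 ≤ S.n := by omega
  have hb : (1 : ℝ) ≤ 1 := le_rfl
  have hT0 := S.TordS_N_zero_real_le P 1 hNq
  have hcX := S.cX_of_hNCW F P hPN hNCW
  have hzeros := P.zerosV_ge'
  refine ⟨S.startCountSat_of_record F (P.schedN 1) hdet hB1, ?_, ?_, ?_, ?_⟩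
  · -- level-0 k-steps
    intro ν hν x₁ hx τ hτ
    have hτ' : tauNorm τ ≤ S.TordS (P.schedN 1) 0 0 := by
      have := S.TordS_N_le_zero P 1 0 ν; omega
    have hE : P.zerosV 0 ν ≤ P.G * (((2 * S.NS (P.schedN 1) 0 ν + 1) * S.tS (P.schedN 1) 0 : ℕ) : ℝ) := P.zerosV_le_gain 0 ν
    have hz := hzeros 0 ν
    refine S.kstep_line_N F P 1 hp hθ hb hn1 hA1 hαA hbW hC hT0 hcX hΛU (Nat.zero_le _) (by omega) hx τ hτ' (by omega) le_rfl ?_ ?_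
    · have h := hKfar ν (by omega)
      unfold PadicG3Par.Zp at h hz
      linarith
    · have h := hKlam 0 ν (Nat.zero_le _) (by omega)
      linarith
  · -- Kummer half-steps
    intro lev hlev s₁ _ hs τ hτ
    have hlev' : lev < P.SdN := hlev
    have hTh := S.TordS_N_half_sub_real_le P 1 lev
    have hE : P.zerosV lev S.n ≤ P.G * (((2 * S.NS (P.schedN 1) lev S.n + 1) * S.tS (P.schedN 1) lev : ℕ) : ℝ) := P.zerosV_le_gain lev S.n
    have hz := hzeros lev S.n
    refine S.half_line_N F P 1 hp hθ hb hn1 hA1 hαA hbW hC hUcol hθA hT0 hcX hTh hΛU hlev' hs τ hτ ?_ ?_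
    · unfold PadicG3Par.Zp at hHfar hz
      linarith
    · have h := hHlam lev hlev'
      linarith
  · -- odd-node k-steps
    intro lev hlev x₁ hx τ hτ
    have hτ' : tauNorm τ ≤ S.TordS (P.schedN 1) 0 0 := by
      have := S.TordS_N_le_zero P 1 (lev + 1) 0; omega
    have hlev' : lev + 1 ≤ P.SdN := hlev
    have hk1 : 1 ≤ 2 * S.NhS (P.schedN 1) (lev + 1) := by
      rw [S.NhS_N P 1]; have := P.one_le_XsV (lev + 1); omega
    have hk : 2 * S.NhS (P.schedN 1) (lev + 1) ≤ 2 * S.NS (P.schedN 1) (lev + 1) 0 + 1 := by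
      rw [S.NhS_N P 1, S.NS_N P 1, pow_zero, one_mul]; omega
    have hE : P.zerosV (lev + 1) 0 ≤ P.G * (((2 * S.NhS (P.schedN 1) (lev + 1)) * S.tS (P.schedN 1) (lev + 1) : ℕ) : ℝ) := by
      rw [S.NhS_N P 1, S.tS_N P 1]
      unfold PadicG3Par.zerosV
      push_cast
      ring_nf
      exact le_rfl
    have hz := hzeros (lev + 1) 0
    refine S.kstep_line_N F P 1 hp hθ hb hn1 hA1 hαA hbW hC hT0 hcX hΛU hlev' (by omega) hx τ hτ' hk1 hk ?_ ?_
    · have h := hKfar 0 (by omega)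
      unfold PadicG3Par.Zp at h hz
      simp only [pow_zero, mul_one] at h hz
      linarith
    · have h := hKlam (lev + 1) 0 hlev' (by omega)
      linarith
  · -- symmetric k-steps of the levels ≥ 1
    intro lev hlev ν hν1 hνn x₁ hx τ hτ
    have hτ' : tauNorm τ ≤ S.TordS (P.schedN 1) 0 0 := by
      have := S.TordS_N_le_zero P 1 (lev + 1) ν; omega
    have hlev' : lev + 1 ≤ P.SdN := hlev
    have hE : P.zerosV (lev + 1) ν ≤ P.G * (((2 * S.NS (P.schedN 1) (lev + 1) ν + 1) * S.tS (P.schedN 1) (lev + 1) : ℕ) : ℝ) :=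
      P.zerosV_le_gain (lev + 1) ν
    have hz := hzeros (lev + 1) ν
    refine S.kstep_line_N F P 1 hp hθ hb hn1 hA1 hαA hbW hC hT0 hcX hΛU hlev' (by omega) hx τ hτ' (by omega) le_rfl ?_ ?_
    · have h := hKfar ν (by omega)
      unfold PadicG3Par.Zp at h hz
      linarith
    · have h := hKlam (lev + 1) ν hlev' (by omega)
      linarith

end G3Setup

end Summit.ABC.StewartYu

end
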